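import Summits.CriticalPhenomena.SAWScalingLimit.Theorems.EventualTight.Negative.EndpointLimitsFalse

/-!
# `EventualTight` — negative knowledge: the quantifier-swapped strengthenings are false

Support file for the crux `stmt-CriticalPhenomena-1372`
(`Summit.CriticalPhenomena.SAWScalingLimit.Theses.SAWRenewalTightness.EventualTight`; refuter
`cdisprove`; work file `Summits/CriticalPhenomena/SAWScalingLimit/Cruxes/EventualTight/Disproof.lean`,
§3). The crux reads `∀ D ∀ (a, b) ∃ δ₀`; both quantifier swaps are FALSE:

* `not_uniformThreshold`: `∀ D ∃ δ₀ ∀ (a, b)` fails for the unit disc — SPLICE the honest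
  approximation `isEndpointApprox_std` below `δ₀/2` with far coincident endpoints on `(δ₀/2, δ₀]`
  (`not_isTightMeasureSet_of_far_branch`); the splice is still an honest `IsEndpointApprox` (it only sees the
  germ at `0⁺`), but its laws on `(δ₀/2, δ₀]` are Dirac masses at constant curves escaping to
  infinity as `δ ↓ δ₀/2`.
* `not_uniformDomains`: a fortiori `∃ δ₀ ∀ D ∀ (a, b)` fails.
(The third strengthening, all meshes `δ ∈ (0, 1]`, is the refuted stmt-0772,
`Theorems/SAWParafermionTightRefutation.lean`.) MORAL: the threshold of the crux must depend on the
approximation. Everything proved, standard axioms. [folklore]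
-/

noncomputable section

open MeasureTheory Filter Topology Set Metric
open Literature.Probability.RandomPlanarGeometry Literature.Probability.RandomPlanarGeometry.SAW
  Literature.Probability.LatticeModels
open scoped ENNReal

namespace Summit.CriticalPhenomena.SAWScalingLimit.Theorems.EventualTight.Negative

open Summit.CriticalPhenomena.SAWScalingLimit.Theorems.SubseqIdentification.Negative
  (isEndpointApprox_std isEndpointApprox_congr)

/-- The spliced endpoints (honest unit-disc approximation below `δ₁`, far coincident sites
`(⌈(δ - δ₁)⁻²⌉₊, 0)` above) form an honest endpoint approximation of `(𝔻; 1, -1)`. [folklore] -/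
theorem isEndpointApprox_splice {δ₁ : ℝ} (hδ₁ : 0 < δ₁) :
    IsEndpointApprox DobrushinDomain.unitDisc
      (fun δ => if δ ≤ δ₁ then ![⌈δ⁻¹⌉ - 1, 0] else ![((⌈(δ - δ₁)⁻¹ ^ 2⌉₊ : ℕ) : ℤ), 0])
      (fun δ => if δ ≤ δ₁ then ![-(⌈δ⁻¹⌉ - 1), 0] else ![((⌈(δ - δ₁)⁻¹ ^ 2⌉₊ : ℕ) : ℤ), 0]) := by
  have hev : ∀ᶠ δ in 𝓝[>] (0 : ℝ), δ ≤ δ₁ :=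
    mem_of_superset (Ioo_mem_nhdsGT hδ₁) fun δ hδ => hδ.2.le
  refine isEndpointApprox_congr isEndpointApprox_std ?_ ?_
  · exact hev.mono fun δ hδ => by simp [hδ]
  · exact hev.mono fun δ hδ => by simp [hδ]

/-- A family of endpoint functions whose branch above `δ₁` is the far coincident site
`(⌈(δ - δ₁)⁻²⌉₊, 0)` has pushed laws that are NOT tight on `(0, δ₀]` (`0 < δ₁ < δ₀`), whatever the
domain: on `(δ₁, δ₀]` the laws are Dirac masses at constant curves of norm `≥ δ (δ - δ₁)⁻²`,
unbounded as `δ ↓ δ₁`. [folklore] -/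
theorem not_isTightMeasureSet_of_far_branch (Ω : Set ℂ) {A B : ℝ → Site 2} {δ₁ δ₀ : ℝ}
    (hδ₁ : 0 < δ₁) (h10 : δ₁ < δ₀)
    (hA : ∀ δ, δ₁ < δ → A δ = ![((⌈(δ - δ₁)⁻¹ ^ 2⌉₊ : ℕ) : ℤ), 0])
    (hB : ∀ δ, δ₁ < δ → B δ = ![((⌈(δ - δ₁)⁻¹ ^ 2⌉₊ : ℕ) : ℤ), 0]) :
    ¬ IsTightMeasureSet
      ((fun δ => (law Ω δ (A δ) (B δ)).map (fun γ => γ.curve)) '' Set.Ioc 0 δ₀) := by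
  intro hT
  rw [isTightMeasureSet_iff_exists_isCompact_measure_compl_le] at hT
  obtain ⟨K, hK, hμ⟩ := hT 2⁻¹ (by simp)
  obtain ⟨R, hR0, hR⟩ := exists_bound_source_of_isCompact hK
  -- the mesh `δ = δ₁ + t`, `t = min (δ₀ - δ₁) (min 1 (δ₁ / (R + 1)))`
  set t : ℝ := min (δ₀ - δ₁) (min 1 (δ₁ / (R + 1))) with ht_def
  have htpos : 0 < t := lt_min (by linarith) (lt_min one_pos (by positivity))
  have ht0 : t ≤ δ₀ - δ₁ := min_le_left _ _
  have ht1 : t ≤ 1 := (min_le_right _ _).trans (min_le_left _ _)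
  have htR : t ≤ δ₁ / (R + 1) := (min_le_right _ _).trans (min_le_right _ _)
  set δ : ℝ := δ₁ + t with hδ_def
  have hδpos : 0 < δ := by positivity
  have hδle : δ ≤ δ₀ := by linarith
  have hgt : δ₁ < δ := by linarith
  have hsub : δ - δ₁ = t := by ring
  -- the far point is beyond `R`
  have hfar : R < ‖meshPoint δ ![((⌈(δ - δ₁)⁻¹ ^ 2⌉₊ : ℕ) : ℤ), 0]‖ := by
    rw [hsub]
    have h1 : δ * t⁻¹ ^ 2 ≤ ‖meshPoint δ ![((⌈t⁻¹ ^ 2⌉₊ : ℕ) : ℤ), 0]‖ :=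
      le_norm_meshPoint_far hδpos.le
    have hA' : t * (R + 1) ≤ δ₁ := (le_div_iff₀ (by positivity)).1 htR
    have hB' : (R + 1) * t ^ 2 ≤ δ := by nlinarith
    have hC : R + 1 ≤ δ * t⁻¹ ^ 2 := by
      rw [inv_pow, ← div_eq_mul_inv, le_div_iff₀ (by positivity)]
      exact hB'
    linarith
  have hle := hμ _ ⟨δ, ⟨hδpos, hδle⟩, rfl⟩
  have hnot : CurveClass.mk (Curve.const (meshPoint δ ![((⌈(δ - δ₁)⁻¹ ^ 2⌉₊ : ℕ) : ℤ), 0])) ∉ K :=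
    fun hin => by
      have h1 := hR _ hin
      simp only [CurveClass.source_mk, Curve.source_def, Curve.const_apply] at h1
      linarith
  have h1 : ((law Ω δ (A δ) (B δ)).map (fun γ => γ.curve)) Kᶜ = 1 := by
    rw [map_law_coincident Ω δ (hA δ hgt) (hB δ hgt), dirac_compl_eq_one hK.isClosed hnot]
  have h2 : (1 : ℝ≥0∞) ≤ 2⁻¹ := h1.symm.le.trans hle
  exact absurd h2 (by norm_num)

/-- **No threshold serves all endpoint approximations of a domain**: the quantifier swap
`∀ D ∃ δ₀ ∀ (a, b)` of the crux is FALSE (unit disc, spliced approximations). [folklore] -/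
theorem not_uniformThreshold :
    ¬ (∀ D : DobrushinDomain, ∃ δ₀ : ℝ, 0 < δ₀ ∧ ∀ a b : ℝ → Site 2, IsEndpointApprox D a b →
        IsTightMeasureSet
          ((fun δ => (law D.carrier δ (a δ) (b δ)).map (fun γ => γ.curve)) '' Set.Ioc 0 δ₀)) := by
  intro h
  obtain ⟨δ₀, hδ₀, hT⟩ := h DobrushinDomain.unitDisc
  exact not_isTightMeasureSet_of_far_branch _ (half_pos hδ₀) (half_lt_self hδ₀)
    (fun δ hδ => if_neg (not_le.2 hδ)) (fun δ hδ => if_neg (not_le.2 hδ))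
    (hT _ _ (isEndpointApprox_splice (half_pos hδ₀)))

/-- A fortiori no threshold serves all domains and approximations: `∃ δ₀ ∀ D ∀ (a, b)` is FALSE.
[folklore] -/
theorem not_uniformDomains :
    ¬ (∃ δ₀ : ℝ, 0 < δ₀ ∧ ∀ (D : DobrushinDomain) (a b : ℝ → Site 2), IsEndpointApprox D a b →
        IsTightMeasureSet
          ((fun δ => (law D.carrier δ (a δ) (b δ)).map (fun γ => γ.curve)) '' Set.Ioc 0 δ₀)) := by
  rintro ⟨δ₀, hδ₀, h⟩
  exact not_uniformThreshold fun D => ⟨δ₀, hδ₀, h D⟩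

end Summit.CriticalPhenomena.SAWScalingLimit.Theorems.EventualTight.Negative

end
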